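import Literature.MathematicalPhysics.QuantumFieldTheory.Balaban1983to89.T4ExpWindowSmallField
import Literature.MathematicalPhysics.QuantumFieldTheory.Balaban1983to89.T4GnomonicWilsonHessian
import Summits.QuantumFields.YangMills.Theorems.UnitScaleTiltMinimiserStabilityRegPrAvgActionDefect
import Summits.QuantumFields.YangMills.Theorems.CovariantDischargeDirectionNet
import HarnessLib

/-!
# S2β ∕ GAP♯∘ strata residue (H′) — THE EXCESS SPLIT: `A(U) − A(U₀)` IS EXACTLY A BACKGROUND-WEIGHTED RELATIVE ACTION
# PLUS A FIRST-ORDER PAIRING, and the docking skeleton «floor of letters» for `hIrr` ∕ `hA`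

Cell `ym3-torus` (YM ladder rung R3 = continuum `SU(2)` Yang–Mills on the three-torus — a RUNG: NOT d = 4, NOT infinite volume,
NOT a mass gap, NOT Clay).  Width seat «width 16» `ym3-torus-px16` (gen 20), FREE px helper on crux `stmt-QuantumFields-20520`
(`FluctuationComparisonRegPrIntL`), count-neutral, DEFINITION-FREE, default heartbeats.

WHERE IT SITS.  The registered S2β stub GAP♯∘ (`stub_uniformFibreGapOrbit`, `Lines/semiclassical_s2beta.lean` v11.4) follows by
✓`…S2BetaGapOrbitOfStrataTwo.uniformFibreGapOrbit_of_strata (hIrr) (hA)` (this seat, after px17 g19's ✓`hFlat_holds`) from the two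
STRATA letters, whose common body is `μ·L^{−2(K−J)}·⨅_w Σ_ℓ dist1(U ℓ·((w•U₀) ℓ)⁻¹)² ≤ A(U) − A(U₀)` at a NON-FLAT argmin base point
`U₀` (UV3-NODE §66).  §66.2 (2) recorded that the excess `A(U) − A(U₀)` «is not a function of `U·U₀⁻¹`».  This file records what it IS,
exactly, in the tree's relative vocabulary (lit `T4TiltOscillation.bdev`, `T4ExpWindowSmallField.plaqDev`): with the RELATIVE PLAQUETTE
`E_p := (U₀(∂p))⁻¹·U(∂p)` and the unit quaternions `q(·) = su2Quat`,

  `A(U) − A(U₀) = Σ_p reTr(U₀(∂p))·(1 − reTr E_p) + Σ_p ⟪imVec q(U₀(∂p)), imVec q(E_p)⟫`      (★★ `wilsonAction4_sub_eq`)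

— no remainder, no expansion, no smallness: the quaternion identity `re(a·e) = re a·re e − ⟨im a, im e⟩`.  The first sum is the
RELATIVE ACTION weighted by `reTr U₀(∂p) = 1 − ½dist1(U₀(∂p))² ≥ 1 − ½θ²` (✓`AvgActionDefect.one_sub_reTr_eq_half_dist1_sq_su2`);
the second («LIN») is ONE bilinear pairing of the background curvature vectors with the relative plaquette vectors — to first
order in a tangent `ξ` at `U₀` it is the first variation `dA_{U₀}[ξ]`, which a stratum road must control through CONSTRAINED
CRITICALITY of the minimiser (multiplier form × second-order averaging kinematics), not termwise.

CONTENTS (theorems only; no `def`, no `instance`, no `sorry`):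
* §1 quaternion ∕ `SU(2)` level: `inner_imVec_eq`, `re_mul_eq_sub_inner`, ★ `reTr_sub_reTr_mul`, ★★ `excess_eq` (pointwise split),
  `abs_inner_imVec_le` (`|⟪·,·⟫| ≤ dist1 P₀·dist1 E`, by ✓`CovariantDischargeDirectionNet.norm_imVec_le_dist1`), `excess_ge_pointwise`,
  `excess_le_pointwise`;
* §2 field level (`U U₀ : GaugeField P j SU(2)`, any `Params`, any level): ★★ `wilsonAction4_sub_eq` (the split), ★ `relAction_le_excess_sub_lin`
  (`(1 − ½θ²)·Σ_p (1 − reTr E_p) ≤ (A(U) − A(U₀)) − LIN` when `dist1 U₀(∂p) ≤ θ`), `abs_lin_le` ∕ `abs_lin_le_mul_sum` ∕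
  `abs_lin_le_mul_sum_plaqDev` (the honest TERMWISE bounds `|LIN| ≤ Σ_p dist1 U₀(∂p)·dist1 E_p ≤ θ·Σ_p dist1 E_p ≤ θ·Σ_p plaqDev U U₀ p` —
  WEAK: good only where the relative action dominates; the strata need LIN through criticality), `abs_mul_add_le_aux` (scalar
  bookkeeping), `abs_excess_le_sum_plaqDev` (`|A(U) − A(U₀)| ≤ Σ_p (½·plaqDev² + θ·plaqDev)`, a Lipschitz-type corollary);
* §3 ★★ `floor_of_letters` (pure reals): from (D) `x ≤ C_D·REL + C_D′·θ·x` (a RELATIVE distance layer), (E) `(1 − ½θ²)·REL ≤ EXC − LIN`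
  (§2), (F) `−LIN ≤ C_L·θ·x + η·REL` (a criticality letter) conclude `((1 − ½θ² − η)·(1 − C_D′θ)∕C_D − C_L·θ)·x ≤ EXC` (`C_D > 0`,
  `1 − ½θ² − η ≥ 0`); the quarter form
  ★ `floor_of_letters_quarter` (`x∕(4C_D) ≤ EXC` under `η ≤ ¼`, `θ² ≤ ½`, `C_D′θ ≤ ¼`, `C_D·C_L·θ ≤ ⅛`); and ★★ `excess_floor_of_letters` —
  the same at field level with `REL := Σ_p (1 − reTr E_p)`, `LIN` the pairing sum and `EXC := A(U) − A(U₀)`: the docking skeleton of the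
  strata letters with `x := L^{−2(K−J)}·⨅_w Σ_ℓ dist1(U ℓ·((w•U₀) ℓ)⁻¹)²`.

HONEST SCOPE.  An identity and bookkeeping over the tree's `SU(2)` chart; nothing of Bałaban's analysis is asserted or proved; the letters
(D) and (F) are HYPOTHESES here (UV3-NODE §-note of this seat names their mechanism and sizes); `hIrr`, `hA`, TUBE-REG∘, GAP♯∘, S2β, the
five registered stubs of `Lines/semiclassical_s2beta.lean` (3732b7df), crux 20520, 19936, 19200 and `YM3TorusSU2` are NOT proved; no
registered stub is closed; the Yang–Mills mass gap is NOT proved.  Sorry-free, axioms standard.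

References: T. Bałaban, CMP **102** (1985) 277–309 [Balaban1985Variational] (Thm 1 (8)–(10) p.279: the minimiser and its curvature;
(34) p.283: plaquette expansion about a background); CMP **102** (1985) 255–275 [Balaban1985UV3] ((7) p.257, (11) p.258).
-/

set_option autoImplicit false

noncomputable section

open scoped Real Quaternion RealInnerProductSpace

namespace Summit.QuantumFields.YangMills.Theorems.FluctuationComparisonRegPrIntLS2BetaExcessSplit

open Literature.MathematicalPhysics.QuantumLattice (su2Quat norm_su2Quat)
open Literature.MathematicalPhysics.QuantumFieldTheory.Balaban1983to89
open Literature.MathematicalPhysics.QuantumFieldTheory.Balaban1983to89.T4CubeChartGnomonic (SU2)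
open Literature.MathematicalPhysics.QuantumFieldTheory.Balaban1983to89.T4ExpWindowSmallField (imVec imVec_apply_zero
  imVec_apply_one imVec_apply_two neg_one_le_re plaqDev dist1_plaqHol_rel_le)
open Literature.MathematicalPhysics.QuantumFieldTheory.Balaban1983to89.T4GnomonicWilsonHessian (reTr_eq_re_su2Quat)
open Literature.MathematicalPhysics.QuantumFieldTheory.Balaban1983to89.T4HaarSU2Translate (su2Quat_mul)
open Summit.QuantumFields.YangMills.Theorems.AvgActionDefect (one_sub_reTr_eq_half_dist1_sq_su2)
open Summit.QuantumFields.YangMills.Theorems.CovariantDischargeDirectionNet (norm_imVec_le_dist1)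
open GaugeField (plaqHol)

/-! ## §1 Quaternion ∕ `SU(2)` level: the pointwise split -/

section Quaternion

/-- The Euclidean pairing of two imaginary vectors, coordinatewise. [folklore] -/
theorem inner_imVec_eq (a e : Quaternion ℝ) :
    inner ℝ (imVec a) (imVec e) = a.imI * e.imI + a.imJ * e.imJ + a.imK * e.imK := by
  rw [PiLp.inner_apply, Fin.sum_univ_three]
  simp only [imVec_apply_zero, imVec_apply_one, imVec_apply_two, RCLike.inner_apply, conj_trivial]
  ring

/-- `re(a·e) = re a·re e − ⟨im a, im e⟩` (Hamilton). [folklore] -/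
theorem re_mul_eq_sub_inner (a e : Quaternion ℝ) : (a * e).re = a.re * e.re - inner ℝ (imVec a) (imVec e) := by
  rw [inner_imVec_eq, Quaternion.re_mul]
  ring

/-- ★ **ONE-FACTOR SPLIT OF THE NORMALISED TRACE**: `reTr P₀ − reTr (P₀·E) = reTr P₀·(1 − reTr E) + ⟪imVec q(P₀), imVec q(E)⟫` on `SU(2)`
(`reTr = re ∘ su2Quat`, lit ✓`reTr_eq_re_su2Quat`; multiplicativity ✓`su2Quat_mul`). [folklore] -/
theorem reTr_sub_reTr_mul (P₀ E : SU2) :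
    reTr P₀ - reTr (P₀ * E) = reTr P₀ * (1 - reTr E) + inner ℝ (imVec (su2Quat P₀)) (imVec (su2Quat E)) := by
  rw [reTr_eq_re_su2Quat, reTr_eq_re_su2Quat, reTr_eq_re_su2Quat, su2Quat_mul, re_mul_eq_sub_inner]
  ring

/-- ★★ **THE POINTWISE EXCESS SPLIT**: with the relative plaquette `E := P₀⁻¹·P`,
`(1 − reTr P) − (1 − reTr P₀) = reTr P₀·(1 − reTr E) + ⟪imVec q(P₀), imVec q(E)⟫` — EXACT, no remainder.
[cite: Balaban1985Variational, (34) p.283] -/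
theorem excess_eq (P₀ P : SU2) :
    (1 - reTr P) - (1 - reTr P₀) =
      reTr P₀ * (1 - reTr (P₀⁻¹ * P)) + inner ℝ (imVec (su2Quat P₀)) (imVec (su2Quat (P₀⁻¹ * P))) := by
  have h := reTr_sub_reTr_mul P₀ (P₀⁻¹ * P)
  rw [mul_inv_cancel_left] at h
  linarith

/-- The pairing is bounded TERMWISE by the product of the chords: `|⟪imVec q(P₀), imVec q(E)⟫| ≤ dist1 P₀·dist1 E` (Cauchy–Schwarz and
`‖imVec q(W)‖ ≤ dist1 W`, ✓`CovariantDischargeDirectionNet.norm_imVec_le_dist1`). [folklore] -/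
theorem abs_inner_imVec_le (P₀ E : SU2) :
    |inner ℝ (imVec (su2Quat P₀)) (imVec (su2Quat E))| ≤ dist1 P₀ * dist1 E :=
  (abs_real_inner_le_norm _ _).trans
    (mul_le_mul (norm_imVec_le_dist1 P₀) (norm_imVec_le_dist1 E) (norm_nonneg _) (GaugeGroup.dist1_nonneg P₀))

/-- Pointwise LOWER bound: `(1 − ½dist1 P₀²)·(1 − reTr E) − dist1 P₀·dist1 E ≤ (1 − reTr P) − (1 − reTr P₀)`, `E = P₀⁻¹·P`
(`reTr P₀ = 1 − ½dist1 P₀²`, ✓`one_sub_reTr_eq_half_dist1_sq_su2`). [folklore] -/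
theorem excess_ge_pointwise (P₀ P : SU2) :
    (1 - 1 / 2 * dist1 P₀ ^ 2) * (1 - reTr (P₀⁻¹ * P)) - dist1 P₀ * dist1 (P₀⁻¹ * P) ≤ (1 - reTr P) - (1 - reTr P₀) := by
  rw [excess_eq]
  have h1 : reTr P₀ = 1 - 1 / 2 * dist1 P₀ ^ 2 := by linarith [one_sub_reTr_eq_half_dist1_sq_su2 P₀]
  have h2 := (abs_le.mp (abs_inner_imVec_le P₀ (P₀⁻¹ * P))).1
  rw [h1]
  linarith

/-- Pointwise UPPER bound: `(1 − reTr P) − (1 − reTr P₀) ≤ (1 − reTr E) + dist1 P₀·dist1 E` (`reTr P₀ ≤ 1`, `1 − reTr E ≥ 0`). [folklore] -/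
theorem excess_le_pointwise (P₀ P : SU2) :
    (1 - reTr P) - (1 - reTr P₀) ≤ (1 - reTr (P₀⁻¹ * P)) + dist1 P₀ * dist1 (P₀⁻¹ * P) := by
  rw [excess_eq]
  have h1 : reTr P₀ ≤ 1 := GaugeGroup.reTr_le_one P₀
  have hE : 0 ≤ 1 - reTr (P₀⁻¹ * P) := by linarith [GaugeGroup.reTr_le_one (P₀⁻¹ * P)]
  have h2 := (abs_le.mp (abs_inner_imVec_le P₀ (P₀⁻¹ * P))).2
  nlinarith

end Quaternion

/-! ## §2 Field level: the split of the excess, the (E)-letter shape, the termwise bounds -/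

section Field

variable {P : Params} {j : ℕ}

/-- ★★ **THE EXCESS SPLIT**: for two configurations `U, U₀` on the same lattice and `E_p := (U₀(∂p))⁻¹·U(∂p)`,
`A(U) − A(U₀) = Σ_p reTr(U₀(∂p))·(1 − reTr E_p) + Σ_p ⟪imVec q(U₀(∂p)), imVec q(E_p)⟫` — background-weighted RELATIVE ACTION plus the
FIRST-ORDER PAIRING («LIN»).  Exact; any `Params`, any level. [cite: Balaban1985Variational, (34) p.283] -/
theorem wilsonAction4_sub_eq (U U₀ : GaugeField P j SU2) :
    wilsonAction4 U - wilsonAction4 U₀ =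
      ∑ p, reTr (plaqHol U₀ p) * (1 - reTr ((plaqHol U₀ p)⁻¹ * plaqHol U p)) +
        ∑ p, inner ℝ (imVec (su2Quat (plaqHol U₀ p))) (imVec (su2Quat ((plaqHol U₀ p)⁻¹ * plaqHol U p))) := by
  simp only [wilsonAction4, wilsonAction, one_mul]
  rw [← Finset.sum_sub_distrib, ← Finset.sum_add_distrib]
  exact Finset.sum_congr rfl fun _ _ => excess_eq _ _

/-- ★ **THE (E)-LETTER SHAPE**: if the background plaquettes satisfy `dist1 U₀(∂p) ≤ θ`, then
`(1 − ½θ²)·Σ_p (1 − reTr E_p) ≤ (A(U) − A(U₀)) − LIN`. [cite: Balaban1985Variational, Thm 1 (9) p.279] -/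
theorem relAction_le_excess_sub_lin {θ : ℝ} (U U₀ : GaugeField P j SU2) (hθ : ∀ p, dist1 (plaqHol U₀ p) ≤ θ) :
    (1 - 1 / 2 * θ ^ 2) * ∑ p, (1 - reTr ((plaqHol U₀ p)⁻¹ * plaqHol U p)) ≤
      (wilsonAction4 U - wilsonAction4 U₀) -
        ∑ p, inner ℝ (imVec (su2Quat (plaqHol U₀ p))) (imVec (su2Quat ((plaqHol U₀ p)⁻¹ * plaqHol U p))) := by
  rw [wilsonAction4_sub_eq, add_sub_cancel_right, Finset.mul_sum]
  refine Finset.sum_le_sum fun p _ => ?_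
  have hE : 0 ≤ 1 - reTr ((plaqHol U₀ p)⁻¹ * plaqHol U p) := by
    linarith [GaugeGroup.reTr_le_one ((plaqHol U₀ p)⁻¹ * plaqHol U p)]
  have h1 : reTr (plaqHol U₀ p) = 1 - 1 / 2 * dist1 (plaqHol U₀ p) ^ 2 := by
    linarith [one_sub_reTr_eq_half_dist1_sq_su2 (plaqHol U₀ p)]
  have hd : dist1 (plaqHol U₀ p) ^ 2 ≤ θ ^ 2 := pow_le_pow_left₀ (GaugeGroup.dist1_nonneg _) (hθ p) 2
  rw [h1]
  exact mul_le_mul_of_nonneg_right (by linarith) hE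

/-- TERMWISE bound on the pairing: `|LIN| ≤ Σ_p dist1 U₀(∂p)·dist1 E_p`. (Weak: useful only where the relative action dominates.) [folklore] -/
theorem abs_lin_le (U U₀ : GaugeField P j SU2) :
    |∑ p, inner ℝ (imVec (su2Quat (plaqHol U₀ p))) (imVec (su2Quat ((plaqHol U₀ p)⁻¹ * plaqHol U p)))| ≤
      ∑ p, dist1 (plaqHol U₀ p) * dist1 ((plaqHol U₀ p)⁻¹ * plaqHol U p) :=
  (Finset.abs_sum_le_sum_abs _ _).trans (Finset.sum_le_sum fun _ _ => abs_inner_imVec_le _ _)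

/-- … hence `|LIN| ≤ θ·Σ_p dist1 E_p` under `dist1 U₀(∂p) ≤ θ`. [folklore] -/
theorem abs_lin_le_mul_sum {θ : ℝ} (U U₀ : GaugeField P j SU2) (hθ : ∀ p, dist1 (plaqHol U₀ p) ≤ θ) :
    |∑ p, inner ℝ (imVec (su2Quat (plaqHol U₀ p))) (imVec (su2Quat ((plaqHol U₀ p)⁻¹ * plaqHol U p)))| ≤
      θ * ∑ p, dist1 ((plaqHol U₀ p)⁻¹ * plaqHol U p) := by
  refine (abs_lin_le U U₀).trans ?_
  rw [Finset.mul_sum]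
  exact Finset.sum_le_sum fun p _ => mul_le_mul_of_nonneg_right (hθ p) (GaugeGroup.dist1_nonneg _)

/-- … and `|LIN| ≤ θ·Σ_p plaqDev U U₀ p` (the relative word bound ✓`dist1_plaqHol_rel_le`: `dist1 E_p ≤ plaqDev U U₀ p`, the sum of the
four bond deviations `dist1 (U₀(b)⁻¹U(b))` around `∂p`; needs `0 ≤ θ`). [folklore] -/
theorem abs_lin_le_mul_sum_plaqDev {θ : ℝ} (U U₀ : GaugeField P j SU2) (hθ0 : 0 ≤ θ) (hθ : ∀ p, dist1 (plaqHol U₀ p) ≤ θ) :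
    |∑ p, inner ℝ (imVec (su2Quat (plaqHol U₀ p))) (imVec (su2Quat ((plaqHol U₀ p)⁻¹ * plaqHol U p)))| ≤
      θ * ∑ p, plaqDev U U₀ p :=
  (abs_lin_le_mul_sum U U₀ hθ).trans
    (mul_le_mul_of_nonneg_left (Finset.sum_le_sum fun p _ => dist1_plaqHol_rel_le U U₀ p) hθ0)

/-- Scalar bookkeeping for the Lipschitz corollary: `|r| ≤ 1`, `e = ½d²`, `0 ≤ d ≤ D`, `|l| ≤ t·d`, `0 ≤ t ≤ θ` give
`|r·e + l| ≤ ½D² + θ·D`. [folklore] -/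
theorem abs_mul_add_le_aux {r e d D l t θ : ℝ} (hr : |r| ≤ 1) (he : e = 1 / 2 * d ^ 2) (hd : 0 ≤ d) (hdD : d ≤ D)
    (hl : |l| ≤ t * d) (ht0 : 0 ≤ t) (ht : t ≤ θ) : |r * e + l| ≤ 1 / 2 * D ^ 2 + θ * D := by
  have he0 : 0 ≤ e := by rw [he]; positivity
  have h1 : |r * e| ≤ 1 / 2 * D ^ 2 := by
    rw [abs_mul, abs_of_nonneg he0]
    have h := mul_le_mul_of_nonneg_right hr he0
    have hdd : d ^ 2 ≤ D ^ 2 := pow_le_pow_left₀ hd hdD 2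
    linarith
  have h2 : |l| ≤ θ * D := hl.trans (mul_le_mul ht hdD hd (ht0.trans ht))
  exact (abs_add_le _ _).trans (add_le_add h1 h2)

/-- **LIPSCHITZ-TYPE COROLLARY**: `|A(U) − A(U₀)| ≤ Σ_p (½·(plaqDev U U₀ p)² + θ·plaqDev U U₀ p)` under `dist1 U₀(∂p) ≤ θ`
(`1 − reTr E_p = ½dist1 E_p² ≤ ½plaqDev²`, `|reTr U₀(∂p)| ≤ 1`). [folklore] -/
theorem abs_excess_le_sum_plaqDev {θ : ℝ} (U U₀ : GaugeField P j SU2) (hθ : ∀ p, dist1 (plaqHol U₀ p) ≤ θ) :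
    |wilsonAction4 U - wilsonAction4 U₀| ≤ ∑ p, (1 / 2 * plaqDev U U₀ p ^ 2 + θ * plaqDev U U₀ p) := by
  rw [wilsonAction4_sub_eq, ← Finset.sum_add_distrib]
  refine (Finset.abs_sum_le_sum_abs _ _).trans (Finset.sum_le_sum fun p _ => ?_)
  have hr1 : reTr (plaqHol U₀ p) ≤ 1 := GaugeGroup.reTr_le_one _
  have hr2 : -1 ≤ reTr (plaqHol U₀ p) := by
    rw [reTr_eq_re_su2Quat]
    exact neg_one_le_re (norm_su2Quat _)
  exact abs_mul_add_le_aux (abs_le.mpr ⟨hr2, hr1⟩) (one_sub_reTr_eq_half_dist1_sq_su2 _) (GaugeGroup.dist1_nonneg _)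
    (dist1_plaqHol_rel_le U U₀ p) (abs_inner_imVec_le _ _) (GaugeGroup.dist1_nonneg _) (hθ p)

end Field

/-! ## §3 The floor of letters (pure reals) and its field-level edition -/

section Letters

/-- ★★ **FLOOR OF LETTERS** (pure reals).  Currencies: `x` (the scaled orbit distance, `≥ 0`), `REL` (relative action), `EXC` (excess),
`LIN` (first-order pairing); letters: (D) `x ≤ C_D·REL + C_D′·θ·x` (relative distance layer), (E) `(1 − ½θ²)·REL ≤ EXC − LIN` (§2),
(F) `−LIN ≤ C_L·θ·x + η·REL` (criticality).  Then `((1 − ½θ² − η)·(1 − C_D′θ)∕C_D − C_L·θ)·x ≤ EXC`, provided `C_D > 0` and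
`1 − ½θ² − η ≥ 0` (no sign condition on `1 − C_D′θ` or `x` is needed). [folklore] -/
theorem floor_of_letters {x REL EXC LIN θ C_D C_D' C_L η : ℝ} (hCD : 0 < C_D) (h1 : 0 ≤ 1 - 1 / 2 * θ ^ 2 - η)
    (hD : x ≤ C_D * REL + C_D' * θ * x) (hE : (1 - 1 / 2 * θ ^ 2) * REL ≤ EXC - LIN)
    (hF : -LIN ≤ C_L * θ * x + η * REL) :
    ((1 - 1 / 2 * θ ^ 2 - η) * (1 - C_D' * θ) / C_D - C_L * θ) * x ≤ EXC := by
  -- (E) + (F): `EXC ≥ (1 − ½θ² − η)·REL − C_L·θ·x`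
  have hEF : (1 - 1 / 2 * θ ^ 2 - η) * REL - C_L * θ * x ≤ EXC := by nlinarith
  -- (D): `(1 − C_D′θ)·x ≤ C_D·REL`, so `REL ≥ (1 − C_D′θ)·x∕C_D`
  have hD' : (1 - C_D' * θ) * x / C_D ≤ REL := by
    rw [div_le_iff₀ hCD]
    nlinarith
  have hmono : (1 - 1 / 2 * θ ^ 2 - η) * ((1 - C_D' * θ) * x / C_D) ≤ (1 - 1 / 2 * θ ^ 2 - η) * REL :=
    mul_le_mul_of_nonneg_left hD' h1
  have halg : ((1 - 1 / 2 * θ ^ 2 - η) * (1 - C_D' * θ) / C_D - C_L * θ) * x =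
      (1 - 1 / 2 * θ ^ 2 - η) * ((1 - C_D' * θ) * x / C_D) - C_L * θ * x := by
    ring
  rw [halg]
  linarith

/-- ★ **QUARTER FORM**: under the displayed smallnesses `η ≤ ¼`, `θ² ≤ ½`, `0 ≤ θ`, `C_D′·θ ≤ ¼`, `C_D·C_L·θ ≤ ⅛` (and `x ≥ 0`) the floor of
letters reads `x∕(4C_D) ≤ EXC`. [folklore] -/
theorem floor_of_letters_quarter {x REL EXC LIN θ C_D C_D' C_L η : ℝ} (hCD : 0 < C_D) (hx : 0 ≤ x) (hη : η ≤ 1 / 4)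
    (hθ1 : θ ^ 2 ≤ 1 / 2) (hθ2 : C_D' * θ ≤ 1 / 4) (hθ3 : C_D * C_L * θ ≤ 1 / 8)
    (hD : x ≤ C_D * REL + C_D' * θ * x) (hE : (1 - 1 / 2 * θ ^ 2) * REL ≤ EXC - LIN)
    (hF : -LIN ≤ C_L * θ * x + η * REL) :
    x / (4 * C_D) ≤ EXC := by
  have h1 : 0 ≤ 1 - 1 / 2 * θ ^ 2 - η := by linarith
  have h2 : 0 ≤ 1 - C_D' * θ := by linarith
  have hfl := floor_of_letters hCD h1 hD hE hF
  -- the coefficient is `≥ (½·¾)∕C_D − C_Lθ ≥ 3∕(8C_D) − 1∕(8C_D) = 1∕(4C_D)`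
  have hcoef : 1 / (4 * C_D) ≤ (1 - 1 / 2 * θ ^ 2 - η) * (1 - C_D' * θ) / C_D - C_L * θ := by
    have hA : 3 / 8 ≤ (1 - 1 / 2 * θ ^ 2 - η) * (1 - C_D' * θ) := by nlinarith
    have hB : C_L * θ ≤ 1 / (8 * C_D) := by
      rw [le_div_iff₀ (by positivity)]
      linarith
    have hC : 3 / (8 * C_D) ≤ (1 - 1 / 2 * θ ^ 2 - η) * (1 - C_D' * θ) / C_D := by
      rw [div_le_div_iff₀ (by positivity) hCD]
      nlinarith
    have hsum : 1 / (4 * C_D) = 3 / (8 * C_D) - 1 / (8 * C_D) := by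
      ring
    rw [hsum]
    linarith
  calc x / (4 * C_D) = 1 / (4 * C_D) * x := by ring
    _ ≤ ((1 - 1 / 2 * θ ^ 2 - η) * (1 - C_D' * θ) / C_D - C_L * θ) * x := mul_le_mul_of_nonneg_right hcoef hx
    _ ≤ EXC := hfl

variable {P : Params} {j : ℕ}

/-- ★★ **THE STRATA DOCKING SKELETON AT FIELD LEVEL**: for `U, U₀ : GaugeField P j SU(2)` with background plaquettes `dist1 U₀(∂p) ≤ θ`,
a scaled distance `x ≥ 0` (for the strata: `x := L^{−2(K−J)}·⨅_w Σ_ℓ dist1(U ℓ·((w•U₀) ℓ)⁻¹)²`), a RELATIVE DISTANCE LETTER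
(D) `x ≤ C_D·Σ_p (1 − reTr E_p) + C_D′·θ·x` and a CRITICALITY LETTER (F) `−LIN ≤ C_L·θ·x + η·Σ_p (1 − reTr E_p)` (`LIN` the pairing sum,
`E_p = (U₀(∂p))⁻¹·U(∂p)`), under the quarter-form smallnesses: `x∕(4C_D) ≤ A(U) − A(U₀)`.  (E) is supplied by §2. [folklore] -/
theorem excess_floor_of_letters {θ C_D C_D' C_L η x : ℝ} (U U₀ : GaugeField P j SU2) (hθ : ∀ p, dist1 (plaqHol U₀ p) ≤ θ)
    (hCD : 0 < C_D) (hx : 0 ≤ x) (hη : η ≤ 1 / 4) (hθ1 : θ ^ 2 ≤ 1 / 2) (hθ2 : C_D' * θ ≤ 1 / 4)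
    (hθ3 : C_D * C_L * θ ≤ 1 / 8)
    (hD : x ≤ C_D * ∑ p, (1 - reTr ((plaqHol U₀ p)⁻¹ * plaqHol U p)) + C_D' * θ * x)
    (hF : -(∑ p, inner ℝ (imVec (su2Quat (plaqHol U₀ p))) (imVec (su2Quat ((plaqHol U₀ p)⁻¹ * plaqHol U p)))) ≤
      C_L * θ * x + η * ∑ p, (1 - reTr ((plaqHol U₀ p)⁻¹ * plaqHol U p))) :
    x / (4 * C_D) ≤ wilsonAction4 U - wilsonAction4 U₀ :=
  floor_of_letters_quarter hCD hx hη hθ1 hθ2 hθ3 hD (relAction_le_excess_sub_lin U U₀ hθ) hF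

end Letters

end Summit.QuantumFields.YangMills.Theorems.FluctuationComparisonRegPrIntLS2BetaExcessSplit

end
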